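import Literature.AlgebraicGeometry.Motives.KatzMessingKunnethProjectors
import Literature.AlgebraicGeometry.Motives.AlgebraicCorrespondencesRationalCharpoly
import HarnessLib

/-!
# Katz–Messing, Theorem 2 (2): rationality of characteristic polynomials of algebraic
# correspondences over a finite field

N. Katz and W. Messing, *Some consequences of the Riemann hypothesis for varieties over finite
fields*, Invent. Math. 23 (1974) 73–77, Theorem 2 (2): for `X` projective and smooth over a finite
field and an algebraic correspondence on `X` (for instance the graph of an endomorphism
`g : X → X`), the characteristic polynomial of its action on `Hⁱ(X)` has rational — indeed integer,
`ℓ`-independent — coefficients. The rationality is the formal consequence of part (1) (the Künneth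
projectors are algebraic) and the Lefschetz trace formula: B. Kahn, *Zeta and L-functions of
varieties and motives* (2020), §6.12 Cor. 6.44 with Prop. 6.41 (3) / Thm. 6.33 ("If `k` is finite,
then `M_num^* = M_num`": over a finite field every motive has algebraic Künneth projectors, so
`Z(f, t) = P(t)^{±1}` with `P ∈ ℚ[t]` for every endomorphism `f` of a motive pure of weight `i`).

For a Galois Weil cohomology theory `E : GaloisWeilCohomology k K χ` over a finite field `k`, a
smooth projective `X` of dimension `n` whose geometric Frobenius acts through a `k`-endomorphism
`φ` (`F | Hⁱ = φ*`, Deligne 1974 (1.15)) and which satisfies the Riemann hypothesis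
(`E.WeilRiemannHypothesisFor X n`, Deligne 1974 Thm. (1.6)), we record:

* `isAlgebraicOperator_pullback_of_weilRiemannHypothesisFor`: for every `k`-endomorphism
  `g : X ⟶ X`, `g* | Hⁱ(X)` is an algebraic operator in the single-bidegree sense of the tree
  (`C(X)` by `KatzMessingKunnethProjectors`, then cut out the component);
* `exists_charpoly_pullback_eq_map_of_weilRiemannHypothesisFor` (**Katz–Messing Thm. 2 (2),
  rational form**): `det(t - g* | Hⁱ(X)) ∈ ℚ[t]`, and likewise `det(1 - t g*)` and `det g*`;
* `exists_charpoly_eq_map_of_weilRiemannHypothesisFor`: the same for every operator on `Hⁱ(X)`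
  induced by an algebraic correspondence with `ℚ`-coefficients.

The integrality and `ℓ`-independence of the printed theorem are not formal in Kleiman's axioms with
`ℚ`-coefficients and are not claimed. Theorems only; nothing restated.

## References

* [KatzMessing1974] N. M. Katz, W. Messing, *Some consequences of the Riemann hypothesis for
  varieties over finite fields*, Invent. Math. 23 (1974), 73–77, Thm. 2 (2).
* [Kahn2020] B. Kahn, *Zeta and L-functions of varieties and motives*, LMS Lecture Note Ser. 462
  (2020), §6.9 Thm. 6.33, §6.12 Prop. 6.41 (3), Cor. 6.44.
* [Deligne1974] P. Deligne, *La conjecture de Weil. I*, Publ. Math. IHÉS 43 (1974), Thm. (1.6),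
  (1.15).
-/

universe u v

open CategoryTheory AlgebraicGeometry Polynomial

noncomputable section

namespace Literature.AlgebraicGeometry.Motives

namespace GaloisWeilCohomology

variable {k : Type u} [Field k] [Finite k] {K : Type v} [Field K] [CharZero K]
  {χ : Field.absoluteGaloisGroup k →* Kˣ} (E : GaloisWeilCohomology k K χ)
variable {n : ℕ} {X : SchemeOver k}

/-- **`g* | Hⁱ(X)` is algebraic for every endomorphism `g` of `X` over a finite field** (under
Frobenius-through-`φ` and the Riemann hypothesis): the Künneth projector `πⁱ` is algebraic
(Katz–Messing Thm. 2 (1), `isAlgebraicOperator_id_of_weilRiemannHypothesisFor`) and cuts the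
degree-`i` component out of the algebraic graded operator `g*`
(`WeilCohomology.isAlgebraicOperator_pullback`). [cite: KatzMessing1974, Thm. 2]
[cite: Kahn2020, §6.9 Thm. 6.33] -/
theorem isAlgebraicOperator_pullback_of_weilRiemannHypothesisFor (hX : IsSmoothProjective n X)
    (φ : X ⟶ X) (hφ : ∀ i : ℕ, E.frobAction X i = E.pullback φ i)
    (hRH : E.WeilRiemannHypothesisFor X n) (g : X ⟶ X) (i : ℕ) :
    E.IsAlgebraicOperator n n (E.pullback g i) :=
  E.isAlgebraicOperator_pullback hX hX g
    (E.isAlgebraicOperator_id_of_weilRiemannHypothesisFor hX φ hφ hRH i)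
    (E.isAlgebraicOperator_id_of_weilRiemannHypothesisFor hX φ hφ hRH i)

/-- **Katz–Messing 1974, Thm. 2 (2) (rational form): the characteristic polynomial of an algebraic
correspondence on `Hⁱ(X)` over a finite field has rational coefficients.** For `X` smooth
projective over the finite field `k`, with Frobenius acting through `φ` and the Riemann hypothesis,
every operator `T : Hⁱ(X) → Hⁱ(X)` induced by an algebraic correspondence with `ℚ`-coefficients
has `det(t - T) ∈ ℚ[t]` (Kahn 2020 Cor. 6.44 with Prop. 6.41 (3): `M_num^* = M_num` over a finite
field). [cite: KatzMessing1974, Thm. 2 (2)] [cite: Kahn2020, §6.12 Cor. 6.44] -/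
theorem exists_charpoly_eq_map_of_weilRiemannHypothesisFor (hX : IsSmoothProjective n X)
    (φ : X ⟶ X) (hφ : ∀ i : ℕ, E.frobAction X i = E.pullback φ i)
    (hRH : E.WeilRiemannHypothesisFor X n) {i : ℕ} {T : E.obj X i →ₗ[K] E.obj X i}
    (hT : E.IsAlgebraicOperator n n T) :
    ∃ P : ℚ[X], (haveI := E.finite_obj hX i; T.charpoly) = P.map (algebraMap ℚ K) :=
  E.exists_charpoly_eq_map_of_isAlgebraicOperator hX
    (E.isAlgebraicOperator_id_of_weilRiemannHypothesisFor hX φ hφ hRH i) hT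

/-- **Katz–Messing 1974, Thm. 2 (2) for endomorphisms**: for every `k`-endomorphism `g : X ⟶ X` of
a smooth projective `X` over a finite field (Frobenius through `φ`, Riemann hypothesis), the
characteristic polynomial `det(t - g* | Hⁱ(X))` is the image of a rational polynomial.
[cite: KatzMessing1974, Thm. 2 (2)] [cite: Kahn2020, §6.12 Cor. 6.44] -/
theorem exists_charpoly_pullback_eq_map_of_weilRiemannHypothesisFor (hX : IsSmoothProjective n X)
    (φ : X ⟶ X) (hφ : ∀ i : ℕ, E.frobAction X i = E.pullback φ i)
    (hRH : E.WeilRiemannHypothesisFor X n) (g : X ⟶ X) (i : ℕ) :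
    ∃ P : ℚ[X],
      (haveI := E.finite_obj hX i; (E.pullback g i).charpoly) = P.map (algebraMap ℚ K) :=
  E.exists_charpoly_eq_map_of_weilRiemannHypothesisFor hX φ hφ hRH
    (E.isAlgebraicOperator_pullback_of_weilRiemannHypothesisFor hX φ hφ hRH g i)

/-- The reversed form `det(1 - t g* | Hⁱ(X)) ∈ ℚ[t]` (the factor of the zeta function of the
endomorphism `g`, Kahn 2020 Cor. 6.44). [cite: KatzMessing1974, Thm. 2 (2)] [cite: Kahn2020, §6.12 Cor. 6.44] -/
theorem exists_reverse_charpoly_pullback_eq_map_of_weilRiemannHypothesisFor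
    (hX : IsSmoothProjective n X) (φ : X ⟶ X) (hφ : ∀ i : ℕ, E.frobAction X i = E.pullback φ i)
    (hRH : E.WeilRiemannHypothesisFor X n) (g : X ⟶ X) (i : ℕ) :
    ∃ P : ℚ[X],
      (haveI := E.finite_obj hX i; (E.pullback g i).charpoly.reverse) = P.map (algebraMap ℚ K) :=
  E.exists_reverse_charpoly_eq_map_of_isAlgebraicOperator hX
    (E.isAlgebraicOperator_id_of_weilRiemannHypothesisFor hX φ hφ hRH i)
    (E.isAlgebraicOperator_pullback_of_weilRiemannHypothesisFor hX φ hφ hRH g i)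

/-- `det (g* | Hⁱ(X)) ∈ ℚ` for every endomorphism `g` of `X` over a finite field (Frobenius through
`φ`, Riemann hypothesis). [cite: KatzMessing1974, Thm. 2 (2)] -/
theorem exists_det_pullback_eq_ratCast_of_weilRiemannHypothesisFor (hX : IsSmoothProjective n X)
    (φ : X ⟶ X) (hφ : ∀ i : ℕ, E.frobAction X i = E.pullback φ i)
    (hRH : E.WeilRiemannHypothesisFor X n) (g : X ⟶ X) (i : ℕ) :
    ∃ q : ℚ, LinearMap.det (E.pullback g i) = q :=
  E.exists_det_eq_ratCast_of_isAlgebraicOperator hX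
    (E.isAlgebraicOperator_id_of_weilRiemannHypothesisFor hX φ hφ hRH i)
    (E.isAlgebraicOperator_pullback_of_weilRiemannHypothesisFor hX φ hφ hRH g i)

/-- **The characteristic polynomial of Frobenius itself is rational** twice over: as an algebraic
correspondence (this file) and as the reverse of the integral model
(`charpoly_frobAction_eq_map_reverse`); here the former, `det(t - F | Hⁱ(X)) ∈ ℚ[t]`.
[cite: KatzMessing1974, Thm. 1] [cite: KatzMessing1974, Thm. 2 (2)] -/
theorem exists_charpoly_frobAction_eq_map_of_weilRiemannHypothesisFor (hX : IsSmoothProjective n X)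
    (φ : X ⟶ X) (hφ : ∀ i : ℕ, E.frobAction X i = E.pullback φ i)
    (hRH : E.WeilRiemannHypothesisFor X n) (i : ℕ) :
    ∃ P : ℚ[X],
      (haveI := E.finite_obj hX i; (E.frobAction X i).charpoly) = P.map (algebraMap ℚ K) := by
  rw [hφ i]
  exact E.exists_charpoly_pullback_eq_map_of_weilRiemannHypothesisFor hX φ hφ hRH φ i

/-- **Inverses of algebraic automorphisms of `Hⁱ(X)` are algebraic over a finite field**
(Lieberman's lemma made unconditional by Katz–Messing Thm. 2 (1)): for `T : Hⁱ(X) → Hⁱ(X)`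
algebraic with two-sided inverse `T'`, `T'` is algebraic. [cite: KatzMessing1974, Thm. 2]
[cite: Kleiman1968AlgebraicCycles, §2] -/
theorem isAlgebraicOperator_of_comp_eq_id_of_weilRiemannHypothesisFor (hX : IsSmoothProjective n X)
    (φ : X ⟶ X) (hφ : ∀ i : ℕ, E.frobAction X i = E.pullback φ i)
    (hRH : E.WeilRiemannHypothesisFor X n) {i : ℕ} {T T' : E.obj X i →ₗ[K] E.obj X i}
    (hT : E.IsAlgebraicOperator n n T) (h₁ : T' ∘ₗ T = LinearMap.id) (h₂ : T ∘ₗ T' = LinearMap.id) :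
    E.IsAlgebraicOperator n n T' :=
  hT.of_comp_eq_id hX (E.isAlgebraicOperator_id_of_weilRiemannHypothesisFor hX φ hφ hRH i) h₁ h₂

/-- **The inverse Frobenius `F⁻¹ | Hⁱ(X)` (the arithmetic Frobenius) is algebraic** over a finite
field under the hypotheses of Katz–Messing (`F` is an algebraic automorphism of `Hⁱ(X)`).
[cite: KatzMessing1974, Thm. 2] [cite: Deligne1974, (1.15)] -/
theorem isAlgebraicOperator_frobAction_inv_of_weilRiemannHypothesisFor (hX : IsSmoothProjective n X)
    (φ : X ⟶ X) (hφ : ∀ i : ℕ, E.frobAction X i = E.pullback φ i)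
    (hRH : E.WeilRiemannHypothesisFor X n) (i : ℕ) :
    E.IsAlgebraicOperator n n
      (((E.isUnit_frobAction X i).unit⁻¹ : (E.obj X i →ₗ[K] E.obj X i)ˣ) :
        E.obj X i →ₗ[K] E.obj X i) := by
  have hF : E.IsAlgebraicOperator n n (E.frobAction X i) := by
    rw [hφ i]
    exact E.isAlgebraicOperator_pullback_of_weilRiemannHypothesisFor hX φ hφ hRH φ i
  exact WeilCohomology.isAlgebraicOperator_unit_inv hX
    (E.isAlgebraicOperator_id_of_weilRiemannHypothesisFor hX φ hφ hRH i)
    (E.isUnit_frobAction X i).unit hF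

end GaloisWeilCohomology

end Literature.AlgebraicGeometry.Motives

end
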